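import Summits.AnomalousDissipation.AnomalousDissipation.Theses.TwoAndHalfD
import Literature.Analysis.FluidPDE.TorusClassicalLerayHopfProofs
import Literature.Analysis.FluidPDE.PassiveScalarWellPosednessProofs
import Literature.Barriers.AnomalousDissipation.GravestModeLaminarAttractorSwept
import Summits.AnomalousDissipation.AnomalousDissipation.Theorems.ScalarAnomalySteadySourceFormal.Negative.ForcedClassicalWeak
import Summits.AnomalousDissipation.AnomalousDissipation.Theorems.ScalarAnomalySteadySourceFormal.Negative.LoadBearing
import Summits.AnomalousDissipation.AnomalousDissipation.Theorems.ScalarAnomalySteadySourceFormal.Negative.RestFlowNoGo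

/-!
# Line `pinned-reservoir-vortex-gas` for crux `TwoAndHalfD.ScalarAnomalySteadySourceFormal`
# (stmt-AnomalousDissipation-0448) — checked skeleton (crux-plan, round 1, 2026-08-16)

Idea card: `Cruxes/ScalarAnomalySteadySourceFormal/Ideas/pinned-reservoir-vortex-gas.md` (triage r1-1/2/3:
pass with doubt on K1/K3; merge-partner `selective-mixing-torque-skeleton`; companions
`budgeted-mixer-template` (kinematic template / transfer) and `isotypic-source-selection` (h-side
sector hygiene)). Line card: `Lines/pinned-reservoir-vortex-gas.md`.

THE LINE. Steady forcing manufactures vorticity INTENSITY for free at the symmetry-pinned zeros of a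
point-reflection-symmetric planar flow (`⟨Δω⟩(x₀) = -curl g(x₀)/ν` at a pin: the localised Marchioro
mechanism); the intense reservoirs shed filaments that roll up into a dilute hierarchy of coherent
satellites, `M ≈ 2 log₂ log(1/ν)` octaves deep (strain `s_m = 2^m/(m log m)`, `Σ 1/s_m < ∞`, cores
`r_m` geometric, energy `Σ a_m² log(1/r_m) < ∞`, `νZ, νP → 0`), whose chaotic point-vortex motion
mixes the complement of the cores at an `O(1)` cascade time and finishes below `λ_M ≈ 1/log²(1/ν)`
by the Batchelor logarithm in time `log(1/ν)/s_M → 0`. What this MUST DELIVER to the scalar clauses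
of the crux — and all that the composition below consumes — is typed in S1: along `ν_j → 0`, a
steadily forced, point-reflection-symmetric classical Navier–Stokes family of bounded energy whose
RELEASES of one odd smooth profile `h` (the source, odd under `x ↦ -x`, hence vanishing on the
axisymmetric sector of all four pins `(0,0),(½,0),(0,½),(½,½)` — the reservoirs cannot trap it)
lose their `L²` mass under a `j`-UNIFORM INTEGRABLE majorant `ρ` of the age: `‖P^j_{s,t} h‖ ≤
ρ(t-s)‖h‖`, `∫₀^∞ ρ ≤ R`. This is deliberately (i) NOT data-universal (triage (★): a data-universal
uniform decay spec bounds `Z_j` via the vorticity twin and is false for every bounded-energy 2-D NS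
family), (ii) NOT even odd-sector-universal (odd data `±1` on a satellite pair `(y,-y)` stay trapped
for the pair's lifetime; only the AGE TAIL of the core population must be integrable, which is what
`ρ` records), (iii) NOT exponential (power tails of core ages allowed). Then: Duhamel turns the
majorant into the variance bound (S3, `⟨‖θ_j‖²⟩ ≤ R²‖h‖²`); a Green–Kubo floor turns uniform release
decay + bounded energy + symmetry into a `j`-uniform dissipation floor (S2 — the one universal
analytic bet of the line: mixing upgrades the Shaw–Thiffeault–Doering `O(κ)` flux floor to `O(1)`);
global classical solvability of the sourced equation supplies the witness scalars (S4); the tree's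
classical⇒weak (`Negative.ForcedClassicalWeak`) and classical⇒Leray–Hopf
(`IsClassicalNSSolutionOn.isLerayHopfOn_of_convex`) lemmas and the `limsup` bookkeeping
(`longTimeAvgSup_le_of_forall_le`) close the crux BY NAME.

STUBS (tree vocabulary only — no local `def`, no notation — so that each can be landed verbatim as
`Theorems/ScalarAnomalySteadySourceFormal/<Stub>.lean --supports stmt-AnomalousDissipation-0448`):
* S1 `stub_pinnedGasOddMixer`      — THE HEART (K3+K1+K2 of the card): NS realises a symmetric
                                     bounded-energy family whose releases of the odd profile `h`
                                     decay under a uniform integrable majorant.            [XL]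
* S2 `stub_greenKuboFloor`         — uniform release decay + bounded energy + symmetry ⇒ a
                                     `j`-uniform floor under `⟨κ‖∇θ‖²⟩ = ⟨(h,θ)⟩` (no asymptotic
                                     coboundary).                                           [L]
* S3 `stub_duhamelVariance`        — release majorant ⇒ `‖θ(t)‖ ≤ R‖h‖` for the sourced solution
                                     from `0` (Duhamel + Minkowski over a smooth drift).     [M]
* S4 `stub_globalSourcedSolution`  — global classical solvability of `∂ₜθ + W·∇θ = κΔθ + h`,
                                     `θ(0) = 0`, over a drift smooth on `[0,∞)` (gluing of the
                                     tree's well-posedness on `[0,T]`).                      [M−]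
Composition `ScalarAnomalySteadySourceFormal_of` (kernel-checked, no `sorry` of its own): S1 gives
`(g, h, ν, v, ρ, R, U)`; S4 the scalars `θ_j`; S3 the pointwise variance bound; S2 the floor constants
`(ε, κ₀)`; shift `j ↦ j + J` so that `ν_j ≤ κ₀`; assemble the eight clauses of the route decl.

DISPROOF USED (`Cruxes/ScalarAnomalySteadySourceFormal/Disproof.lean` gen 1, cycles 1–2b @ 2026-08-16T01:54Z;
certified copies `Theorems/ScalarAnomalySteadySourceFormal/Negative/{KillShape, ForcedClassicalWeak,
HeatProfile, LoadBearing, RestFlowSteady, RestFlowNoGo, ForcedToolkit, ForcedModes}` — three imported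
above). The file has no literal `_false_without_<H>` theorem; its load-bearing theorems play that
role and are honoured as follows. `Negative.cruxWithoutVarianceBound_holds` (clause (v) is what a
PROOF must earn honestly): (v) is earned by S3 from S1's integrable release majorant — a MIXING
statement, not a budget — and certified junk-free (`scalarL2Sq` of smooth slices, pointwise bound ⇒
`longTimeAvgSup_le_of_forall_le`). `Negative.cruxIndexedSource_holds` (ONE fixed `h`): `h` is produced
once by S1 before `ν` is quantified and is the same function in S2–S4 for every `j`.
`Negative.not_cruxRestFlow` / dead family (a): S1's family cannot be at rest — at rest the release of
`h` decays only like `e^{-κλ₁(t-s)}`, whose age-integral `1/(κλ₁)` is not `j`-uniform. Dead family (b)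
(Galilean drifts): excluded by the point-reflection symmetry of S1 (zero momentum, `v = 0` at the four
pins). Dead families (c) single-shell / (d) autonomous / (e) uniformly Lipschitz: each contradicts S1's
uniform release decay (ν-uniform `H¹` ⇒ DiPerna–Lions conservation of the limit release; autonomous
cells relax at `κ^{1/3}`; Lipschitz `L` ⇒ Batchelor time `log(1/κ)/L`), so S1 forces `Z_j → ∞`,
`⟨‖∇v_j‖_{L¹}⟩ ≳ log(1/ν_j)` (card P2) and `‖∇v_j‖_∞ ≳ log(1/ν_j)` — exactly the vortex-gas window.
§2 junk calculus: the floor clause is junk-proof (KillShape §2); S2 concludes it for classical scalars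
whose dissipation means are bounded by `‖h‖√B` (energy identity), so `longTimeAvgSup` is an honest
`limsup` there. No stub is an instance of a landed Negative lemma (none is at rest, none indexes the
source, none drops (v)). `ledger negatives --problem AnomalousDissipation` (4 entries, 3-D ∀-data
ceilings 13037/2984/2979/2859): none related, none reused.
-/

namespace Summit.AnomalousDissipation.AnomalousDissipation.Cruxes.ScalarAnomalySteadySourceFormal.PinnedReservoirVortexGas

open MeasureTheory Filter Topology Set
open scoped ENNReal NNReal
open Literature.Analysis.FunctionSpaces Literature.Analysis.FluidPDE
open Literature.Barriers.AnomalousDissipation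
open Summit.AnomalousDissipation.AnomalousDissipation.Theses.TwoAndHalfD
open Summit.AnomalousDissipation.AnomalousDissipation.Theorems.ScalarAnomalySteadySourceFormal.Negative

set_option linter.dupNamespace false

/-! ## S1 — the heart: NS realises a symmetric bounded-energy family mixing the releases of `h` -/

/-- **S1 `stub_pinnedGasOddMixer` — THE HEART (card K3 → K1 → K2; hardest stub).** There are a
smooth, divergence-free, mean-zero steady force `g` and a smooth mean-zero source profile `h` on `T²`,
BOTH ODD under the point reflection `x ↦ -x` (recommended design, not typed: `g` with `C₄`-symmetric
vorticity forcing `G = A(cos 2πk_a·) + B(cos 2πk_b·)` on TWO shells `k_a < k_b` — single-shell forcing is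
dead, item evidence SINGLE_SHELL_2HALFD — and `h` in the `P`-odd isotypic component
`span{sin 2πx₁, sin 2πx₂}`, which vanishes at all four pins and is `L²`-orthogonal to every
`C₄`-invariant field (`ω`, `ψ`, `curl g`); caveat for the provers: keep `h ⊥` the components of `g`,
since `⟨(g, v_j)⟩ = ν_j Z_j → 0` (Alexakis–Doering) starves `g`-correlated profiles), viscosities
`ν_j → 0⁺`, and for each `j` a CLASSICAL solution `(v_j, p_j)` of the 2-D Navier–Stokes system forced
by `g` on `[0,∞) × T²` (data on the selected invariant set are smooth), odd under the point
reflection at every `t ≥ 0` (so `v_j = 0` at `(0,0),(½,0),(0,½),(½,½)`: the PINS), with energy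
`∫‖v_j(t)‖² ≤ U²` for all `t ≥ 0` uniformly in `j`, such that the RELEASES of `h` are mixed uniformly:
there is ONE antitone `ρ ≥ 0` with `∫₀ᵗ ρ ≤ R` for all `t ≥ 0` such that for every `j`, every release
time `s ≥ 0` and every classical solution `φ` of the UNFORCED advection–diffusion equation
`∂ₜφ + v_j·∇φ = ν_jΔφ` on a window `[s, T']` with `φ(s) = h`:
`‖φ(t)‖² ≤ ρ(t-s)² ‖h‖²` on `[s, T']` (`scalarL2Sq = ∫ φ²`).
WHY PLAUSIBLY TRUE (the card's mechanism, with the triage-corrected window): pinned reservoirs of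
core vorticity `A = G₀ t_res` (exact pinned-curvature identity `⟨Δω⟩(0) = -curl g(0)/ν`, card (B) /
support P1) shed intense filaments (`A ≫` ambient strain) that roll up away from the parent into a
dilute satellite gas on octaves `λ_m = 2^{-m}`, `m ≤ M ≈ 2log₂log(1/ν)`, bulk velocities
`a_m = 1/(m log m)`, strains `s_m = 2^m a_m` (`Σ1/s_m < ∞`: cascade time `O(1)`), cores `r_m = e^{-c'm}`
(merger enstrophy loss `Z_M s_M r_M = O(1)`, triage r1-3 A2), energy `Σ a_m² c'm < ∞`, `Z, P = polylog`,
`νZ, νP → 0`; releases of `h` cascade down one octave per local turnover and are finished below `λ_M`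
in time `log(1/ν)/s_M → 0` (ELM, arXiv:2304.05374 Thm 1, rescaled); the variance share trapped in
cores of age `≥ τ` is the core-age tail, which chaotic renewal on `ν`-independent times `t_ren,m` (card
K1) makes integrable — this tail IS `ρ`. WHY IT MIGHT FAIL: 2-D turbulence populates scales ABOVE the
injection scale and leaves strain-dominated debris below it (Dritschel 1989; Dritschel–Waugh 1992);
the fed reservoir phase may be absorbing (runaway to the Marchioro cell, `t_res ~ ν⁻¹`;
`Literature.Barriers.AnomalousDissipation.Marchioro1986_globalAttraction`) or drained (`O(1)` residence,
`√ν`-spike, triage r1-1) — K3's dichotomy; long-lived low-level cores would make `ρ` non-integrable.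
NECESSARY SHAPE it honours (Disproof §5 (c)–(e), card P2): `Z_j → ∞`, `⟨‖∇v_j‖_{L¹}⟩ ≳ log(1/ν_j)`,
`‖∇v_j‖_∞ ≳ log(1/ν_j)`, no uniform `W^{1,p}` bound for any `p > 1` — all satisfied by the window.
Leans on: `Torus.IsClassicalNSSolutionOn`, `Torus.IsClassicalScalarTransportOn`, `Torus.scalarL2Sq`;
print: Babiano–Boffetta–Provenzale–Vulpiani 1994 (chaotic advection by point vortices), Burgess–Scott
2017 (vortex populations), arXiv:1707.05525 (core exchange times), arXiv:2304.05374 Thm 1,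
arXiv:1310.2986 Thm 1.1, GalletYoung2013. Alternative certificate route (reshape, line card): a
uniform HALVING TIME on the whole odd sector iterates (the odd sector is propagator-invariant for
symmetric `v_j`) and implies this stub with `ρ = 2·2^{-τ/τ₀}` — stronger, finite-window, but exposed to
trapped odd data in satellite pairs. Size XL. -/
theorem stub_pinnedGasOddMixer :
    ∃ (g : UnitAddTorus (Fin 2) → EuclideanSpace ℝ (Fin 2)) (h : UnitAddTorus (Fin 2) → ℝ),
      Torus.IsSmooth g ∧ Torus.IsDivFree g ∧ Torus.HasZeroMean g ∧ (∀ x, g (-x) = -g x) ∧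
      Torus.IsSmooth h ∧ Torus.HasZeroMean h ∧ (∀ x, h (-x) = -h x) ∧ 0 < Torus.scalarL2Sq h ∧
      ∃ (ν : ℕ → ℝ) (v : ℕ → ℝ → UnitAddTorus (Fin 2) → EuclideanSpace ℝ (Fin 2))
        (p : ℕ → ℝ → UnitAddTorus (Fin 2) → ℝ) (U R : ℝ) (ρ : ℝ → ℝ),
        (∀ j, 0 < ν j) ∧ Tendsto ν atTop (𝓝 0) ∧
        (∀ j, Torus.IsClassicalNSSolutionOn (Ici 0) (ν j) (fun _ => g) (v j) (p j)) ∧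
        (∀ j (t : ℝ), 0 ≤ t → ∀ x, v j t (-x) = -(v j t x)) ∧
        (∀ j (t : ℝ), 0 ≤ t → ∫ x, ‖v j t x‖ ^ 2 ≤ U ^ 2) ∧
        Antitone ρ ∧ (∀ τ, 0 ≤ ρ τ) ∧ (∀ t : ℝ, 0 ≤ t → ∫ τ in (0 : ℝ)..t, ρ τ ≤ R) ∧
        (∀ j (s T' : ℝ), 0 ≤ s → s < T' → ∀ φ : ℝ → UnitAddTorus (Fin 2) → ℝ,
          Torus.IsClassicalScalarTransportOn (Icc s T') (ν j) (v j) φ → φ s = h →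
          ∀ t ∈ Icc s T', Torus.scalarL2Sq (φ t) ≤ ρ (t - s) ^ 2 * Torus.scalarL2Sq h) := by
  sorry

/-! ## S2 — the Green–Kubo floor: uniform mixing of the releases of `h` forbids flux starvation -/

/-- **S2 `stub_greenKuboFloor` — mixing upgrades the `O(κ)` steady-source flux floor to `O(1)`.**
Fix a smooth profile `h ≠ 0` odd under `x ↦ -x`, an antitone majorant `ρ ≥ 0` with `∫₀ᵗ ρ ≤ R`, an
energy level `U` and a variance level `B`. Then there are `ε > 0` and `κ₀ > 0` such that for every
diffusivity `0 < κ ≤ κ₀`, every drift `W` (jointly smooth and divergence free on `[0,∞)` — recorded in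
the classical-solution hypothesis) which is odd under the point reflection and has `∫‖W(t)‖² ≤ U²` for
all `t ≥ 0`, whose releases of `h` obey the majorant (`‖φ(t)‖² ≤ ρ(t-s)²‖h‖²` for every classical
solution of `∂ₜφ + W·∇φ = κΔφ` on `[s,T']` from `φ(s) = h`, `s ≥ 0`), and every classical solution `θ`
of the SOURCED equation `∂ₜθ + W·∇θ = κΔθ + h` on `[0,∞)` with `θ(0) = 0` and `‖θ(t)‖² ≤ B`:
`ε ≤ limsup_T T⁻¹∫₀ᵀ κ‖∇θ(t)‖² dt` (the crux's floor clause verbatim: spectral `eScalarGradNormSq`,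
`toReal`, `longTimeAvgSup`). WHY PLAUSIBLY TRUE: for classical solutions the energy identity
`d/dt ½‖θ‖² = -κ‖∇θ‖² + (h,θ)` and `‖θ‖² ≤ B` give `⟨κ‖∇θ‖²⟩ = ⟨(h,θ)⟩` with Cesàro means bounded by
`‖h‖√B` (so the `limsup` is honest, Disproof §2), and by Duhamel `(h, θ(t)) = ∫₀ᵗ C(s,t) ds` with the
release autocorrelation `C(s,t) = (h, P_{s,t}h)`: `C(t,t) = ‖h‖²`, `|∂ₜC| ≤ (U‖∇h‖_∞ + κ‖Δh‖₂)‖h‖`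
(energy bound: the pattern of `h` cannot be swept faster than `Ā = U‖∇h‖_∞/‖h‖`), `|C(s,t)| ≤
ρ(t-s)‖h‖²` (uniform mixing kills the tail); flux starvation `⟨(h,θ)⟩ → 0` would need coherent
ANTI-correlation of the release with `h` at frequencies `≫` the decay rate, which bounded energy caps
(e.g. a symmetric sloshing shear tuned to a Bessel zero still leaves `⟨(h,θ)⟩ ≳ ‖h‖² c/(c² + Ω²)`,
`Ω ≲ 10U`, `c ≳ 1/R`); Galilean sweeping — the flow that saturates the kinematic `O(κ)` floor of
Shaw–Thiffeault–Doering (physics/0607270 (III.23)–(III.29)) — is excluded by the point-reflection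
symmetry. In the autonomous case the floor reads `(h, A⁻¹h) = κ‖∇A^{-*}h‖² ≥ ε` for `A = W·∇ - κΔ`
with `‖e^{-tA}h‖ ≤ ρ(t)‖h‖`: "a uniformly mixed profile is not an approximate coboundary". WHY IT
MIGHT FAIL: `h` an asymptotic coboundary of the family (`W_j·∇η_j ≈ h` with `η_j` smooth on scales
`≫ √κ_j`) despite uniform release decay — Green–Kubo cancellation; every crude head–tail bound needs
decay FASTER than sweeping (`c ≳ 3Ā`), which is unphysical, so a proof must use the sign structure of
`C` (Gram/positivity of the propagator family or a test-function/duality argument). Reshape if it dies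
universally: fold the floor into S1 as a family-specific Green–Kubo clause. This is card
budgeted-mixer-template's K3 / ideator-4's FluxFloorCriterion made quantitative; honours
`Negative.cruxIndexedSource_holds` (one fixed `h`) and the junk audit (classical integrands). Leans
on: `Torus.IsClassicalScalarTransportForcedOn`, `Torus.eScalarGradNormSq`, `longTimeAvgSup`,
`scalarL2Sq_add_scalarDissipation_holds` (unforced energy identity; forced twin to vendor),
`exists_unique_isClassicalScalarTransportForcedOn_holds` (releases exist), `Negative.KillShape` §2
(`isBoundedUnder_timeMean_of_le_longTimeAvgSup`). Print: physics/0607270; arXiv:1911.11014 Rem 1.7;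
Gordin–Livšic coboundary criteria. Size L. -/
theorem stub_greenKuboFloor :
    ∀ (h : UnitAddTorus (Fin 2) → ℝ) (ρ : ℝ → ℝ) (R U B : ℝ),
      Torus.IsSmooth h → Torus.HasZeroMean h → (∀ x, h (-x) = -h x) → 0 < Torus.scalarL2Sq h →
      Antitone ρ → (∀ τ, 0 ≤ ρ τ) → (∀ t : ℝ, 0 ≤ t → ∫ τ in (0 : ℝ)..t, ρ τ ≤ R) →
      ∃ ε κ₀ : ℝ, 0 < ε ∧ 0 < κ₀ ∧
        ∀ (κ : ℝ) (W : ℝ → UnitAddTorus (Fin 2) → EuclideanSpace ℝ (Fin 2))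
          (θ : ℝ → UnitAddTorus (Fin 2) → ℝ),
          0 < κ → κ ≤ κ₀ →
          (∀ t : ℝ, 0 ≤ t → ∀ x, W t (-x) = -(W t x)) →
          (∀ t : ℝ, 0 ≤ t → ∫ x, ‖W t x‖ ^ 2 ≤ U ^ 2) →
          (∀ (s T' : ℝ), 0 ≤ s → s < T' → ∀ φ : ℝ → UnitAddTorus (Fin 2) → ℝ,
            Torus.IsClassicalScalarTransportOn (Icc s T') κ W φ → φ s = h →
            ∀ t ∈ Icc s T', Torus.scalarL2Sq (φ t) ≤ ρ (t - s) ^ 2 * Torus.scalarL2Sq h) →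
          Torus.IsClassicalScalarTransportForcedOn (Ici 0) κ W (fun _ => h) θ →
          (∀ x, θ 0 x = 0) →
          (∀ t : ℝ, 0 ≤ t → Torus.scalarL2Sq (θ t) ≤ B) →
          ε ≤ longTimeAvgSup (fun t => κ * (Torus.eScalarGradNormSq (θ t)).toReal) := by
  sorry

/-! ## S3 — Duhamel: an integrable release majorant bounds the sourced variance -/

/-- **S3 `stub_duhamelVariance` — `‖θ(t)‖ ≤ (∫₀ᵗ ρ)‖h‖ ≤ R‖h‖`.** For `κ > 0`, a smooth profile
`h`, an antitone majorant `ρ ≥ 0` with `∫₀ᵗ ρ ≤ R` (`t ≥ 0`), and a drift `W` (jointly smooth,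
divergence free on `[0,∞)`, as recorded in the classical hypothesis) whose releases of `h` obey
`‖φ(t)‖² ≤ ρ(t-s)²‖h‖²` (every classical solution of the unforced equation on `[s,T']` from `φ(s) = h`,
`0 ≤ s < T'`): every classical solution `θ` of `∂ₜθ + W·∇θ = κΔθ + h` on `[0,∞)` with `θ(0) = 0`
satisfies `‖θ(t)‖² ≤ R²‖h‖²` for all `t ≥ 0`. WHY TRUE: the releases `φ^{(s)}` exist on every window
(`exists_unique_isClassicalScalarTransportForcedOn_holds` after the time translation `t ↦ t - s` of
`IsSmoothSpaceTimeOn` / `IsClassicalScalarTransportOn`, with `isClassicalScalarTransportForcedOn_zero_iff`)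
and are unique (`IsClassicalScalarTransportForcedOn.eq_on_Icc`); the two-parameter family is jointly
smooth (or: Riemann sums `Σ_k Δs·φ^{(s_k)}(t)` solve the unforced equation between grid times and
converge to `θ` by the energy estimate for the difference), so Duhamel `θ(t) = ∫₀ᵗ φ^{(s)}(t) ds`
holds, and Minkowski gives `‖θ(t)‖ ≤ ∫₀ᵗ ρ(t-s)‖h‖ ds = ‖h‖∫₀ᵗ ρ ≤ R‖h‖` (`ρ` antitone ⇒ interval
integrable, `Antitone.intervalIntegrable`; the hypothesis at `t = 0` forces `R ≥ 0`). The card's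
`DecayGivesBoundedVariance` (budgeted-mixer-template P1) for ONE profile and an integrable (not
exponential) rate. Leans on: `Torus.IsClassicalScalarTransportForcedOn`, `Torus.IsClassicalScalarTransportOn`,
`exists_unique_isClassicalScalarTransportForcedOn_holds`, `IsClassicalScalarTransportForcedOn.sub`,
`antitoneOn_scalarL2Sq`, `hasDerivWithinAt_scalarL2Sq_holds`. Size M. -/
theorem stub_duhamelVariance :
    ∀ (κ : ℝ) (W : ℝ → UnitAddTorus (Fin 2) → EuclideanSpace ℝ (Fin 2)) (h : UnitAddTorus (Fin 2) → ℝ)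
      (ρ : ℝ → ℝ) (R : ℝ),
      0 < κ → Torus.IsSmooth h →
      Antitone ρ → (∀ τ, 0 ≤ ρ τ) → (∀ t : ℝ, 0 ≤ t → ∫ τ in (0 : ℝ)..t, ρ τ ≤ R) →
      (∀ (s T' : ℝ), 0 ≤ s → s < T' → ∀ φ : ℝ → UnitAddTorus (Fin 2) → ℝ,
        Torus.IsClassicalScalarTransportOn (Icc s T') κ W φ → φ s = h →
        ∀ t ∈ Icc s T', Torus.scalarL2Sq (φ t) ≤ ρ (t - s) ^ 2 * Torus.scalarL2Sq h) →
      ∀ θ : ℝ → UnitAddTorus (Fin 2) → ℝ,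
        Torus.IsClassicalScalarTransportForcedOn (Ici 0) κ W (fun _ => h) θ → (∀ x, θ 0 x = 0) →
        ∀ t : ℝ, 0 ≤ t → Torus.scalarL2Sq (θ t) ≤ R ^ 2 * Torus.scalarL2Sq h := by
  sorry

/-! ## S4 — global classical solvability of the sourced equation over a drift smooth on `[0,∞)` -/

/-- **S4 `stub_globalSourcedSolution` — the witness scalars exist as global classical solutions.**
For `κ > 0`, a drift `W` jointly smooth on `[0,∞) × T²` and divergence free for `t ≥ 0`, and a smooth
steady source `h`, there is a classical solution `θ` of `∂ₜθ + W·∇θ = κΔθ + h` on all of `[0,∞)`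
(`IsClassicalScalarTransportForcedOn (Ici 0)`) with `θ(0) = 0`. WHY TRUE: the tree PROVES existence and
uniqueness on every `[0,T]` (`exists_unique_isClassicalScalarTransportForcedOn_holds`,
`IsClassicalScalarTransportForcedOn.eq_on_Icc`); glue `θ(t) := θ^{[0,⌈t⌉+1]}(t)`: uniqueness makes the
windows agree, `timeDerivWithin`/`IsSmoothSpaceTimeOn (Ici 0)` are local (`ContDiffOn` congruence on
`[0,T) × T²`, relatively open in `[0,∞) × T²`), so the glued function is a classical solution on
`[0,∞)`. Global-in-time classical well-posedness, absent from the tree (the provers' half of the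
route's foreseen `SourcedScalarWellPosed2D`). Leans on: `exists_unique_isClassicalScalarTransportForcedOn_holds`,
`IsClassicalScalarTransportForcedOn.eq_on_Icc`, `IsSmoothSpaceTimeOn`, `isSmoothSpaceTimeOn_const`.
Size M−. -/
theorem stub_globalSourcedSolution :
    ∀ (κ : ℝ) (W : ℝ → UnitAddTorus (Fin 2) → EuclideanSpace ℝ (Fin 2)) (h : UnitAddTorus (Fin 2) → ℝ),
      0 < κ → Torus.IsSmoothSpaceTimeOn (Ici 0) W → (∀ t : ℝ, 0 ≤ t → Torus.IsDivFree (W t)) →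
      Torus.IsSmooth h →
      ∃ θ : ℝ → UnitAddTorus (Fin 2) → ℝ,
        Torus.IsClassicalScalarTransportForcedOn (Ici 0) κ W (fun _ => h) θ ∧ ∀ x, θ 0 x = 0 := by
  sorry

/-! ## The composition (kernel-checked; no `sorry` of its own) -/

/-- **`ScalarAnomalySteadySourceFormal` from S1–S4.** Take the design `(g, h)` and the family
`(ν_j, v_j)` with release majorant `(ρ, R)` and energy level `U` from S1; the sourced scalars `θ_j`
from S4 (datum `0`); the pointwise variance bound `R²‖h‖²` from S3; the floor constants `(ε, κ₀)` from
S2; shift the index so that `ν_j ≤ κ₀`; the planar flows are global Leray–Hopf from their own smooth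
data (`IsClassicalNSSolutionOn.isLerayHopfOn_of_convex`), the scalars are global weak forced solutions
(`Negative.isWeakScalarTransportForcedOn_of_classical`), and pointwise bounds pass to `limsup` means
(`meanEnergy_le_of_forall_le`, `longTimeAvgSup_le_of_forall_le`). -/
theorem ScalarAnomalySteadySourceFormal_of : ScalarAnomalySteadySourceFormal := by
  obtain ⟨g, h, hgs, hgd, hgm, -, hhs, hhm, hhodd, hhpos, ν, v, p, U, R, ρ, hν, hν0, hNS, hvodd, hU,
    hρa, hρ0, hρR, hdec⟩ := stub_pinnedGasOddMixer
  -- the witness scalars (S4)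
  have hex : ∀ j, ∃ θ : ℝ → UnitAddTorus (Fin 2) → ℝ,
      Torus.IsClassicalScalarTransportForcedOn (Ici 0) (ν j) (v j) (fun _ => h) θ ∧ ∀ x, θ 0 x = 0 :=
    fun j => stub_globalSourcedSolution (ν j) (v j) h (hν j) (hNS j).smooth_velocity
      (fun t ht => (hNS j).divFree t ht) hhs
  choose θf hθf hθf0 using hex
  -- pointwise variance bound (S3)
  have hvar : ∀ j (t : ℝ), 0 ≤ t → Torus.scalarL2Sq (θf j t) ≤ R ^ 2 * Torus.scalarL2Sq h :=
    fun j => stub_duhamelVariance (ν j) (v j) h ρ R (hν j) hhs hρa hρ0 hρR (hdec j) (θf j) (hθf j)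
      (hθf0 j)
  -- floor constants (S2) and the index shift `j ↦ j + J` making `ν_j ≤ κ₀`
  obtain ⟨ε, κ₀, hε, hκ₀, hfl⟩ :=
    stub_greenKuboFloor h ρ R U (R ^ 2 * Torus.scalarL2Sq h) hhs hhm hhodd hhpos hρa hρ0 hρR
  obtain ⟨J, hJ⟩ : ∃ J : ℕ, ∀ j ≥ J, ν j ≤ κ₀ :=
    eventually_atTop.1 (hν0.eventually (ge_mem_nhds hκ₀))
  refine ⟨g, h, hgs, hgd, hgm, hhs, hhm, fun j => ν (j + J), fun j => v (j + J) 0,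
    fun j => v (j + J), fun _ _ => 0, fun j => θf (j + J), fun j => hν (j + J), ?_, ?_,
    fun _ => memLp_const 0, ?_, ⟨U ^ 2, fun j => ?_⟩, ⟨R ^ 2 * Torus.scalarL2Sq h, fun j => ?_⟩,
    ε, hε, fun j => ?_⟩
  · exact hν0.comp (tendsto_add_atTop_nat J)
  · intro j T hT
    exact (hNS (j + J)).isLerayHopfOn_of_convex (convex_Ici 0) hT Icc_subset_Ici_self
  · intro j T hT
    have h0 : θf (j + J) 0 = fun _ => 0 := funext (hθf0 (j + J))
    have hw := isWeakScalarTransportForcedOn_of_classical (T := T) (hθf (j + J)) Icc_subset_Ici_self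
    rw [h0] at hw
    exact hw
  · exact meanEnergy_le_of_forall_le fun t ht => hU (j + J) t ht.le
  · exact longTimeAvgSup_le_of_forall_le (fun t _ => Torus.scalarL2Sq_nonneg _)
      fun t ht => hvar (j + J) t ht.le
  · exact hfl (ν (j + J)) (v (j + J)) (θf (j + J)) (hν (j + J)) (hJ _ (Nat.le_add_left J j))
      (hvodd (j + J)) (hU (j + J)) (hdec (j + J)) (hθf (j + J)) (hθf0 (j + J)) (hvar (j + J))

end Summit.AnomalousDissipation.AnomalousDissipation.Cruxes.ScalarAnomalySteadySourceFormal.PinnedReservoirVortexGas
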